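import Summits.BirchSwinnertonDyer.BirchSwinnertonDyer.Theorems.EisensteinPrimesAcTwistDeformationLocalClasses
import HarnessLib

/-!
# Route `EisensteinPrimes` (rung K5), crux 2 `GoodLatticeBDPValue`, line `halves` v16, stub
# `stub_imprimCorank`, road (A): the `K_∞`-SIDE GLOBAL-TO-LOCAL SURJECTIVITY — every family of local
# classes `y_{w,i} ∈ H¹(ker κ ⊓ D_w, M)` (`w ∈ S₀`, `i < p^{a_w}` = the places of `K_∞` above `w`) is the
# family of local components `res_{ker κ ⊓ D_w} conj_{σ_{w,i}} u` of ONE class `u ∈ H¹_{𝓕_nr^{S₀}}(K_∞, M)`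
# (helper for stmt-BirchSwinnertonDyer-19032)

Cell `bsd-eis`, seat `bsd-line-x1-p1` LEAD g2 (D-0154 row 4); eighth file of road (A). This is the `≥` half
of the `S`-relaxation corank identity ([KellerYin2024] Prop. 1.2.5 (eq:Gr to imp), [PollackWeston2011]
Prop. A.2: "`H¹_{𝓕_nr^S} → ∏_{w∈S} H¹(K_{∞,w}, M) → 0` … by the surjectivity of the global-to-local map")
DERIVED IN THE KERNEL from Greenberg's `SUR(𝐃₁, 𝓛_v)` for the one-variable twist deformation
`𝐃₁ = A ⊗ Λ^*(κ⁻¹)` (file 3 `bigRep_fullAt_SUR`, itself from [Greenberg2016Selmer] Prop. 2.6.3 BY NAME and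
Greenberg 2006 Props. 3.2/4.1/4.2/§5A BY NAME) through Shapiro's lemma (files 4, 6, 7):

* **`exists_mem_unrSelmer_forall_resOfLe_conjH1_eq`** — under the hypotheses of `bigRep_fullAt_SUR`
  (`K` imaginary quadratic, `A ≃ ℚ_p/ℤ_p` with scalar `G_{K,S}`-action `ρ₀ ↔ M` via `ψ`, `S ⊇ {v, v̄} ∪ S₀`
  finite with `κ(D_w) ≠ 1` on `S`, `p ∈ v, v̄`, `S_{𝓛_v}(K, 𝐃₁)` of `Λ`-corank `0`), for a finite set `S₀ ⊆ S`
  of places `w ∤ p` with `κ(D_w) = p^{a_w} ℤ_p` exactly, elements `σ_{w,i} ∈ Γ_K` with `κ(σ_{w,i}) = i`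
  (`i < p^{a_w}`), and ANY targets `y_{w,i} ∈ H¹(ker κ ⊓ D_w, M)`: there is `u ∈ H¹_{𝓕_nr^{S₀}}(K_∞, M)` with
  `res_{ker κ ⊓ D_w}(conj_{σ_{w,i}} u) = y_{w,i}` for all `w ∈ S₀`, `i < p^{a_w}`.
  Proof: transport the targets to cocycles `z_{w,i}` on `ker(κ|Γ_{K_w})` (inverse of `ψ`), glue them into
  one local cocycle `c_w` of `𝐃₁|Γ_{K_w}` with `c_w(τ)(i) = z_{w,i}(τ)` (file 6, local Shapiro surjectivity),
  realise `(c_w)_{w ∈ S₀}` (and `0` at the other places `≠ v`) as `loc` of a global `ξ` (`SUR`), descend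
  `u = F ξ` (file 4) — it lands in `H¹_{𝓕_nr^{S₀}}` (file 7 §2) and its local components are the evaluation
  classes at `κ(σ_{w,i}) = i` (file 7 §3), i.e. the `y_{w,i}`.

Theorems only; conditional only through the by-name facts fed to `bigRep_fullAt_SUR` (`prop263_sur_of_crk`,
Greenberg 2006 §3–5); no `sorry`. HONEST FRAMING: closes nothing by itself (`--supports`); BSD / the crux
are not advanced by this file alone. References: [Greenberg2016Selmer] Prop. 2.6.3, §1 p. 3;
[SkinnerUrban2014] §3.1.2, Prop. 3.2.3; [KellerYin2024] Prop. 1.2.5; [PollackWeston2011] App. A Prop. A.2;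
[GreenbergVatsal2000] §2 pp. 16–17, 20–22.
-/

set_option autoImplicit false
set_option linter.dupNamespace false

noncomputable section

open scoped Classical
open NumberField IsDedekindDomain Field Multiplicative PowerSeries
open Literature.NumberTheory.EllipticCurves Literature.NumberTheory.EllipticCurves.GreenbergSelmer
  Literature.NumberTheory.EllipticCurves.GreenbergVatsal2000 Literature.NumberTheory.GaloisRepresentations
  Literature.NumberTheory.EllipticCurves.KellerYin2024 Literature.NumberTheory.EllipticCurves.IwasawaDual
  Literature.NumberTheory.IwasawaTheory Literature.NumberTheory.IwasawaTheory.Greenberg2016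
  Literature.NumberTheory.IwasawaTheory.Greenberg2006
  Summit.BirchSwinnertonDyer.BirchSwinnertonDyer.Theorems.GreenbergFullAtSelmer

namespace Summit.BirchSwinnertonDyer.BirchSwinnertonDyer.Theorems.AcTwistDeformation

section LocSurj

variable {K : Type} [Field K] [NumberField K] (S : Set (HeightOneSpectrum (𝓞 K))) {p : ℕ} [Fact p.Prime]
  {A : Type} [AddCommGroup A] [Module ℤ_[p] A] [TopologicalSpace A] [DiscreteTopology A]
  [TopologicalSpace (PowerSeries ℤ_[p])] [IsTopologicalRing (PowerSeries ℤ_[p])]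
  [IsTopologicalAddGroup (BigRepModule ℤ_[p] p A)] [ContinuousSMul (PowerSeries ℤ_[p]) (BigRepModule ℤ_[p] p A)]
  (hS : ∀ v : HeightOneSpectrum (𝓞 K), ((p : ℕ) : 𝓞 K) ∈ v.asIdeal → v ∈ S)
  (κ : ZpExtension K p) (ρ₀ : ContinuousRep (GaloisGroupUnramifiedOutside K S) ℤ_[p] A)
  {M : Type} [AddCommGroup M] [DistribMulAction (absoluteGaloisGroup K) M] [TopologicalSpace M]
  [DiscreteTopology M]
  (ψ : A ≃+ M) (hψ : ∀ (σ : absoluteGaloisGroup K) (a : A), ψ (ρ₀ (toUnramifiedQuot K S σ) a) = σ • ψ a)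

/-! ## §1 Local cocycles of `𝐃₁|Γ_{K_w}` with prescribed evaluation classes -/

omit [IsTopologicalRing (PowerSeries ℤ_[p])] in
include hψ in
/-- **A local cocycle of `𝐃₁` at `w` with prescribed evaluations.** For a finite place `w` with
`κ(D_w) = p^a ℤ_p` exactly and cocycles `ζ_i` (`i < p^a`) of `ker κ ⊓ D_w` in `M`, there is a continuous
crossed homomorphism `c_w : Γ_{K_w} → 𝐃₁` (for `𝐃₁|Γ_{K_w}`) with `ζ_i(x) = ψ(c_w(τ)(i))` whenever `τ ∈ Γ_{K_w}`
restricts to `x`: local Shapiro surjectivity (file 6) for `κ|Γ_{K_w}`, `ρ₀|Γ_{K_w}` and the transported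
cocycles `τ ↦ ψ⁻¹ ζ_i(τ̄)` on `ker(κ|Γ_{K_w}) ⥲ ker κ ⊓ D_w`. [cite: SkinnerUrban2014, §3.1.2 ((3.1.2.a)–(3.1.2.b))]
[cite: SerreGaloisCohomology1997, I §2.5] -/
theorem exists_localCocycle_forall_eval (hA : ∀ a : A, ∃ k : ℕ, p ^ k • a = 0)
    (w : HeightOneSpectrum (𝓞 K)) {a : ℕ}
    (hdiv : ∀ δ ∈ decomp (K := K) w, (p : ℤ_[p]) ^ a ∣ (κ δ).toAdd)
    (hd₀ : ∃ δ ∈ decomp (K := K) w, (κ δ).toAdd = (p : ℤ_[p]) ^ a)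
    (ζ : ℕ → contOneCocycles (discreteTopRep ↥(κ.kerSubgroup ⊓ decomp (K := K) w) M)) :
    ∃ c' : contOneCocycles
        (localRep S (bigRep (κ.liftUnramifiedOutside S hS) ρ₀) (Sum.inr w : Place K)).toTopRep,
      ∀ i : ℕ, i < p ^ a →
        ∀ (x : ↥(κ.kerSubgroup ⊓ decomp (K := K) w)) (τ : absoluteGaloisGroup (w.adicCompletion K)),
          absGaloisRestrict K (w.adicCompletion K) τ = (x : absoluteGaloisGroup K) →
          (ζ i).1 x = ψ ((c'.1 τ : BigRepModule ℤ_[p] p A) (i : ℕ)) := by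
  -- the local group `D = Γ_{K_w}`, compact and totally disconnected
  let Fw : Type := w.adicCompletion K
  let D : Type := absoluteGaloisGroup (w.adicCompletion K)
  haveI : CompactSpace D := absoluteGaloisGroup_compactSpace Fw
  haveI : TotallyDisconnectedSpace D := by
    change TotallyDisconnectedSpace (AlgebraicClosure Fw ≃ₐ[Fw] AlgebraicClosure Fw); infer_instance
  let κD : D →ₜ* Multiplicative ℤ_[p] := κ.toContinuousMonoidHom.comp (absGaloisRestrict K Fw)
  let ρD : ContinuousRep D ℤ_[p] A := ρ₀.restrict (localToUnramified S (Sum.inr w : Place K))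
  have hκD : ∀ t : D, κD t = κ (absGaloisRestrict K Fw t) := fun _ ↦ rfl
  have hρD : ∀ t : D, ρD t = ρ₀ (toUnramifiedQuot K S (absGaloisRestrict K Fw t)) := fun _ ↦ rfl
  -- `ker κ_D → ker κ ⊓ D_w`
  let θ₁ : (κD : D →* Multiplicative ℤ_[p]).ker →ₜ* ↥(κ.kerSubgroup ⊓ decomp (K := K) w) :=
    { toFun := fun t ↦ ⟨absGaloisRestrict K Fw t, Subgroup.mem_inf.2
        ⟨ZpExtension.mem_kerSubgroup.2 (by rw [← hκD]; exact (MonoidHom.mem_ker).1 t.2),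
          (mem_decomp_iff w _).2 ⟨(t : D), rfl⟩⟩⟩
      map_one' := Subtype.ext (by simp)
      map_mul' := fun x y ↦ Subtype.ext (by simp)
      continuous_toFun :=
        ((absGaloisRestrict K Fw).continuous_toFun.comp continuous_subtype_val).subtype_mk _ }
  have hθ₁ : ∀ t : (κD : D →* Multiplicative ℤ_[p]).ker,
      ((θ₁ t : ↥(κ.kerSubgroup ⊓ decomp (K := K) w)) : absoluteGaloisGroup K) = absGaloisRestrict K Fw t :=
    fun _ ↦ rfl
  -- the transported cocycles
  let z : Fin (p ^ a) → (κD : D →* Multiplicative ℤ_[p]).ker → A := fun i t ↦ ψ.symm ((ζ i).1 (θ₁ t))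
  have hzc : ∀ i, Continuous (z i) := fun i ↦
    (continuous_of_discreteTopology (f := (ψ.symm : M → A))).comp ((ζ i).1.continuous.comp θ₁.continuous_toFun)
  have hz : ∀ (i) (t₁ t₂ : (κD : D →* Multiplicative ℤ_[p]).ker),
      z i (t₁ * t₂) = z i t₁ + ρD (t₁ : D) (z i t₂) := by
    intro i t₁ t₂
    change ψ.symm ((ζ i).1 (θ₁ (t₁ * t₂))) = ψ.symm ((ζ i).1 (θ₁ t₁)) + ρD (t₁ : D) (ψ.symm ((ζ i).1 (θ₁ t₂)))
    have hcoc := (ζ i).2 (θ₁ t₁) (θ₁ t₂)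
    rw [map_mul, hcoc, map_add]
    congr 1
    apply ψ.injective
    rw [ψ.apply_symm_apply, hρD, hψ, ψ.apply_symm_apply]
    rfl
  -- `κ_D(D) = p^a ℤ_p` exactly
  have hdivD : ∀ d : D, (p : ℤ_[p]) ^ a ∣ (κD d).toAdd := fun d ↦
    hdiv _ ((mem_decomp_iff w _).2 ⟨d, rfl⟩)
  obtain ⟨δ, hδ, hδa⟩ := hd₀
  obtain ⟨d₀, hd₀'⟩ := (mem_decomp_iff w _).1 hδ
  have hd₀D : (κD d₀).toAdd = (p : ℤ_[p]) ^ a := by rw [hκD, hd₀', hδa]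
  -- local Shapiro surjectivity
  obtain ⟨cD, hcDc, hcDcoc, hcDev⟩ := exists_cocycle_apply_natCast_eq κD ρD hA hdivD hd₀D z hzc hz
  -- `bigRep κ_D ρ_D = 𝐃₁|Γ_{K_w}`
  have hbig : ∀ (τ : D) (Φ : BigRepModule ℤ_[p] p A), bigRep κD ρD τ Φ =
      bigRep (κ.liftUnramifiedOutside S hS) ρ₀ (localToUnramified S (Sum.inr w : Place K) τ) Φ := by
    intro τ Φ
    ext x
    rw [bigRep_apply_apply, bigRep_apply_apply, hρD, hκD,
      show localToUnramified S (Sum.inr w : Place K) τ = toUnramifiedQuot K S (absGaloisRestrict K Fw τ) from rfl,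
      ZpExtension.liftUnramifiedOutside_mk]
  refine ⟨⟨⟨cD, hcDc⟩, fun g h ↦ ?_⟩, fun i hi x τ hτ ↦ ?_⟩
  · have h1 := hcDcoc g h
    rw [hbig] at h1
    exact h1
  · have hτker : τ ∈ (κD : D →* Multiplicative ℤ_[p]).ker := by
      rw [MonoidHom.mem_ker]
      change κD τ = 1
      rw [hκD, hτ]
      exact ZpExtension.mem_kerSubgroup.1 (Subgroup.mem_inf.1 x.2).1
    have hev := hcDev ⟨i, hi⟩ ⟨τ, hτker⟩
    have hθx : θ₁ ⟨τ, hτker⟩ = x := Subtype.ext hτ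
    change cD τ (i : ℕ) = ψ.symm ((ζ i).1 (θ₁ ⟨τ, hτker⟩)) at hev
    rw [hθx] at hev
    change (ζ i).1 x = ψ (cD τ (i : ℕ))
    rw [hev, ψ.apply_symm_apply]

/-! ## §2 The `K_∞`-side surjectivity -/

include hψ in
/-- **`K_∞`-SIDE GLOBAL-TO-LOCAL SURJECTIVITY, IN THE KERNEL FROM `SUR(𝐃₁, 𝓛_v)`.** Hypotheses: those of
`bigRep_fullAt_SUR` (Greenberg 2016 Prop. 2.6.3 and Greenberg 2006 §3–5 BY NAME; `K` imaginary quadratic;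
`A ≃ ℚ_p/ℤ_p` with scalar action; `S` finite, `⊇ {w ∣ p} = {v, v̄}`, every `w ∈ S` finitely decomposed;
`corank_Λ S_{𝓛_v}(K, 𝐃₁) = 0`, e.g. from [RH] via file 5), the Shapiro descent `F` of `ψ : A ≃ M`, a finite
`S₀ ⊆ S` of places `w ∤ p` with `κ(D_w) = p^{a_w} ℤ_p` exactly, elements `σ_{w,i}` with `κ(σ_{w,i}) = i`.
Conclusion: for ANY `y_{w,i} ∈ H¹(ker κ ⊓ D_w, M)` there is `u ∈ H¹_{𝓕_nr^{S₀}}(K_∞, M)` with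
`res_{ker κ ⊓ D_w}(conj_{σ_{w,i}} u) = y_{w,i}` (`w ∈ S₀`, `i < p^{a_w}`) — the map
`H¹_{𝓕_nr^{S₀}}(K_∞, M) → ∏_{w ∈ S₀} ∏_{η ∣ w} H¹(K_{∞,η}, M)` is ONTO.
[cite: Greenberg2016Selmer, Prop. 2.6.3 and §1 p. 3] [cite: KellerYin2024, Prop. 1.2.5 (eq:Gr to imp) (arXiv:2402.12781v2 TeX L789–800)]
[cite: PollackWeston2011, App. A, Prop. A.2 (proof)] [cite: SkinnerUrban2014, §3.1.2 and Prop. 3.2.3] -/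
theorem exists_mem_unrSelmer_forall_resOfLe_conjH1_eq (h263 : prop263_sur_of_crk)
    (h41 : prop41_globalEulerPoincareCorank) (h42 : prop42_localEulerPoincareCorank)
    (h5A : sec5A_localH2_subsingleton_of_LOC1) (h32 : prop32_cohomology_isCofinitelyGenerated)
    (hSf : S.Finite) (hK : IsImaginaryQuadratic K) (e : A ≃ₗ[ℤ_[p]] QpModZp p)
    (hscalar : ∀ g : GaloisGroupUnramifiedOutside K S, ∃ t : ℤ_[p]ˣ, ∀ a : A, ρ₀ g a = (t : ℤ_[p]) • a)
    (hsup : ∀ v : HeightOneSpectrum (𝓞 K), v ∈ S →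
      ∃ σ : absoluteGaloisGroup (Place.Completion (Sum.inr v : Place K)),
        κ (absGaloisRestrict K _ σ) ≠ 1)
    {v vbar : HeightOneSpectrum (𝓞 K)} (hne : vbar ≠ v)
    (hv : ((p : ℕ) : 𝓞 K) ∈ v.asIdeal) (hvbar : ((p : ℕ) : 𝓞 K) ∈ vbar.asIdeal)
    (hSp : ∀ w : HeightOneSpectrum (𝓞 K), ((p : ℕ) : 𝓞 K) ∈ w.asIdeal → w = v ∨ w = vbar)
    (hSel : HasCorank (PowerSeries ℤ_[p])
      (fullAtSpecification S (bigRep (κ.liftUnramifiedOutside S hS) ρ₀) (Sum.inr v)).selmer 0)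
    (hSelfg : IsCofinitelyGenerated (PowerSeries ℤ_[p])
      (fullAtSpecification S (bigRep (κ.liftUnramifiedOutside S hS) ρ₀) (Sum.inr v)).selmer)
    (hA : ∀ a : A, ∃ k : ℕ, p ^ k • a = 0)
    {F : (bigRep (κ.liftUnramifiedOutside S hS) ρ₀).H 1 →+ subgroupH1 κ.kerSubgroup M}
    (hF : ∀ (c : contOneCocycles (bigRep (κ.liftUnramifiedOutside S hS) ρ₀).toTopRep)
      (z : contOneCocycles (discreteTopRep κ.kerSubgroup M)),
      (∀ h : κ.kerSubgroup, z.1 h = ψ ((c.1 (toUnramifiedQuot K S h) : BigRepModule ℤ_[p] p A) 0)) →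
      F (oneCocycleClass _ c) = oneCocycleClass _ z)
    (S₀ : Finset (HeightOneSpectrum (𝓞 K))) (hS₀S : ∀ w ∈ S₀, w ∈ S)
    (hS₀p : ∀ w ∈ S₀, ((p : ℕ) : 𝓞 K) ∉ w.asIdeal) (a : HeightOneSpectrum (𝓞 K) → ℕ)
    (hdiv : ∀ w ∈ S₀, ∀ δ ∈ decomp (K := K) w, (p : ℤ_[p]) ^ a w ∣ (κ δ).toAdd)
    (hd₀ : ∀ w ∈ S₀, ∃ δ ∈ decomp (K := K) w, (κ δ).toAdd = (p : ℤ_[p]) ^ a w)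
    (σrep : HeightOneSpectrum (𝓞 K) → ℕ → absoluteGaloisGroup K)
    (hσrep : ∀ w ∈ S₀, ∀ i : ℕ, i < p ^ a w → (κ (σrep w i)).toAdd = (i : ℤ_[p]))
    (y : ∀ w : HeightOneSpectrum (𝓞 K), ℕ → subgroupH1 (κ.kerSubgroup ⊓ decomp (K := K) w) M) :
    ∃ u ∈ unrSelmer κ M vbar (↑S₀ : Set (HeightOneSpectrum (𝓞 K))),
      ∀ w ∈ S₀, ∀ i : ℕ, i < p ^ a w →
        resOfLe M (inf_le_left : κ.kerSubgroup ⊓ decomp (K := K) w ≤ κ.kerSubgroup)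
          (conjH1 κ.kerSubgroup M (σrep w i) u) = y w i := by
  -- cocycle representatives of the targets
  have hζex : ∀ (w : HeightOneSpectrum (𝓞 K)) (i : ℕ),
      ∃ ζ : contOneCocycles (discreteTopRep ↥(κ.kerSubgroup ⊓ decomp (K := K) w) M),
        oneCocycleClass _ ζ = y w i := fun w i ↦ oneCocycleClass_surjective _ _
  choose ζ hζ using hζex
  -- local cocycles at the places of `S₀`
  have hcls : ∀ w : HeightOneSpectrum (𝓞 K), w ∈ S₀ →
      ∃ c' : contOneCocycles (localRep S (bigRep (κ.liftUnramifiedOutside S hS) ρ₀) (Sum.inr w : Place K)).toTopRep,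
        ∀ i : ℕ, i < p ^ a w →
          ∀ (x : ↥(κ.kerSubgroup ⊓ decomp (K := K) w)) (τ : absoluteGaloisGroup (w.adicCompletion K)),
            absGaloisRestrict K (w.adicCompletion K) τ = (x : absoluteGaloisGroup K) →
            (ζ w i).1 x = ψ ((c'.1 τ : BigRepModule ℤ_[p] p A) (i : ℕ)) := fun w hw ↦
    exists_localCocycle_forall_eval S hS κ ρ₀ ψ hψ hA w (hdiv w hw) (hd₀ w hw) (ζ w)
  choose c' hc' using hcls
  -- the local targets: `[c'_w]` at `w ∈ S₀`, `0` elsewhere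
  let xloc : ∀ w : HeightOneSpectrum (𝓞 K), (localRep S (bigRep (κ.liftUnramifiedOutside S hS) ρ₀) (Sum.inr w : Place K)).H 1 := fun w ↦
    if hw : w ∈ S₀ then oneCocycleClass _ (c' w hw) else 0
  let xall : ∀ pl : Place K, (localRep S (bigRep (κ.liftUnramifiedOutside S hS) ρ₀) pl).H 1 := fun pl ↦
    @Sum.rec (InfinitePlace K) (HeightOneSpectrum (𝓞 K)) (fun pl ↦ (localRep S (bigRep (κ.liftUnramifiedOutside S hS) ρ₀) pl).H 1)
      (fun _ ↦ 0) (fun w ↦ xloc w) pl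
  let q : (fullAtSpecification S (bigRep (κ.liftUnramifiedOutside S hS) ρ₀) (Sum.inr v)).QGlobal := fun η ↦
    (fullAtSpecification S (bigRep (κ.liftUnramifiedOutside S hS) ρ₀) (Sum.inr v) η.1).mkQ (xall η.1)
  -- `SUR(𝐃₁, 𝓛_v)`
  have hSUR : (fullAtSpecification S (bigRep (κ.liftUnramifiedOutside S hS) ρ₀) (Sum.inr v)).SUR :=
    bigRep_fullAt_SUR (S := S) (hS := hS) (κ := κ) (ρ₀ := ρ₀) h263 h41 h42 h5A h32 hSf hK e hscalar hsup hne hv hvbar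
      hSel hSelfg
  obtain ⟨ξ, hξ⟩ := hSUR q
  obtain ⟨c, rfl⟩ := oneCocycleClass_surjective _ ξ
  -- the local components of `[c]` at the finite `w ∈ S`, `w ≠ v`
  have hcomp : ∀ w : HeightOneSpectrum (𝓞 K), w ∈ S → w ≠ v →
      loc S (bigRep (κ.liftUnramifiedOutside S hS) ρ₀) (Sum.inr w) 1 (oneCocycleClass _ c) = xloc w := by
    intro w hwS hwv
    have hη := congrFun hξ ⟨Sum.inr w, (inSigma_inr_iff S w).mpr hwS⟩
    simp only [Specification.phi, LinearMap.pi_apply, LinearMap.coe_comp, Function.comp_apply, q, xall] at hη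
    rw [Submodule.mkQ_apply, Submodule.mkQ_apply, Submodule.Quotient.eq,
      fullAtSpecification_of_ne (S := S) (ρ := bigRep (κ.liftUnramifiedOutside S hS) ρ₀)
        (η := (Sum.inr v : Place K)) (w := (Sum.inr w : Place K)) (fun h ↦ hwv (Sum.inr_injective h)), Submodule.mem_bot,
      sub_eq_zero] at hη
    exact hη
  -- landing in `H¹_{𝓕_nr^{S₀}}`
  have hloc0 : ∀ w : HeightOneSpectrum (𝓞 K), w ∈ S → w ≠ v → w ∉ (↑S₀ : Set (HeightOneSpectrum (𝓞 K))) ∨ w = vbar →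
      loc S (bigRep (κ.liftUnramifiedOutside S hS) ρ₀) (Sum.inr w) 1 (oneCocycleClass _ c) = 0 := by
    intro w hwS hwv hw
    rw [hcomp w hwS hwv]
    have hw' : w ∉ S₀ := by
      rcases hw with hw | rfl
      · exact fun h ↦ hw (Finset.mem_coe.mpr h)
      · exact fun h ↦ hS₀p _ h hvbar
    exact dif_neg hw'
  refine ⟨F (oneCocycleClass _ c),
    shapiroDescent_mem_unrSelmer_of_loc_eq_zero S hS κ ρ₀ ψ hψ hA hF hv hne hSp _ c hloc0,
    fun w hw i hi ↦ ?_⟩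
  -- the local components are the evaluation classes
  have hwv : w ≠ v := fun h ↦ hS₀p w hw (h ▸ hv)
  have hcc' : loc S (bigRep (κ.liftUnramifiedOutside S hS) ρ₀) (Sum.inr w) 1 (oneCocycleClass _ c) = oneCocycleClass _ (c' w hw) := by
    rw [hcomp w (hS₀S w hw) hwv]
    exact dif_pos hw
  rw [← hζ w i]
  refine resOfLe_conjH1_shapiroDescent_eq S hS κ ρ₀ ψ hψ hF w (σrep w i) c (c' w hw) hcc' (ζ w i)
    fun x τ hτ ↦ ?_
  rw [hσrep w hw i hi]
  exact hc' w hw i hi x τ hτ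

end LocSurj

end Summit.BirchSwinnertonDyer.BirchSwinnertonDyer.Theorems.AcTwistDeformation

end
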